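import Literature.Probability.LatticeModels.CircleWeightBondModel
import Literature.Probability.LatticeModels.VillainKernelPoisson
import Literature.MathematicalPhysics.QuantumLattice.HeatKernelGroupCircleKernelProofs
import Mathlib.Analysis.Complex.ExponentialBounds
import HarnessLib

/-!
# Trigonometric moments of the Villain single-bond law: `∫ zⁿ v_β(arg z) dz = e^{-n²/(2β)}/√(2πβ)`

For the Villain weight `W = villainCircleWeight β` (`v_β(arg z)`, `CircleWeightBondModel.lean`) on
`U(1)` with its Haar probability measure (`β > 0`):

* `integral_coe_zpow_mul_villainCircleWeight` — `∫ zⁿ W(z) dz = e^{-n²/(2β)}/√(2πβ)` (term-wise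
  integration of the Poisson / Fourier form `v_β(arg z) = ∑_m (e^{-m²/(2β)}/√(2πβ)) z^m`,
  `hasSum_villainKernel_fourier_circle`, against the orthogonality of characters);
* `circleWeightZ_villain` — `Z_W = 1/√(2πβ)`; `integral_im_mul_villainCircleWeight` — `∫ Im z W = 0`;
* `circleWeightMean_villain` — the mean resultant is **`λ = e^{-1/(2β)}`** (Garban–Spencer's `λ(β)`
  for the Villain interaction, replacing `I₁(β)/I₀(β)`); `circleWeightMean_villain_pos`,
  `circleWeightMean_villain_le_one`, and `inv_circleWeightMean_villain_le` — `λ⁻¹ = e^{1/(2β)} ≤ 1 + 2/β`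
  for `β ≥ 1` (the input format of the tree's overlap-moment bookkeeping, cf. `inv_vonMisesMean_le`).

Theorems only.

## References

* J. Fröhlich, T. Spencer, Comm. Math. Phys. 83 (1982) 411–454, §2.2 (2.2)–(2.3) (Fourier
  coefficients of the Villain weight). [FrohlichSpencerCMP1982]
* C. Garban, T. Spencer, arXiv:2109.01617, (2.5) and Remark 10. [GarbanSpencer2022]
-/

noncomputable section

open MeasureTheory Finset TopologicalSpace Filter Complex
open scoped BigOperators ComplexConjugate Topology Real

namespace Literature.Probability.LatticeModels

open Literature.MathematicalPhysics.QuantumFieldTheory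
open Literature.MathematicalPhysics.QuantumLattice (integral_tsum_mul_coe_zpow_haarProbability_circle)

variable [MeasurableSpace Circle] [BorelSpace Circle] {β : ℝ}

/-- **`∫ zⁿ v_β(arg z) dz = e^{-n²/(2β)}/√(2πβ)`** (`n ∈ ℤ`, `β > 0`): the Fourier coefficients of the
Villain weight (term-wise integration of `v_β(arg z) = ∑_m (e^{-m²/(2β)}/√(2πβ)) z^m` and
orthogonality; the coefficients are even in `m`). [cite: FrohlichSpencerCMP1982, §2.2 (2.2)–(2.3)] -/
theorem integral_coe_zpow_mul_villainCircleWeight (hβ : 0 < β) (n : ℤ) :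
    ∫ z, (z : ℂ) ^ n * villainCircleWeight β z ∂Measure.haarMeasure (⊤ : PositiveCompacts Circle) =
      ((Real.exp (-((n : ℝ) ^ 2) / (2 * β)) / Real.sqrt (2 * π * β) : ℝ) : ℂ) := by
  set c : ℤ → ℂ := fun m => ((Real.exp (-((m : ℝ) ^ 2) / (2 * β)) / Real.sqrt (2 * π * β) : ℝ) : ℂ) with hc
  have hexp : ∀ z : Circle, (z : ℂ) ^ n * (villainCircleWeight β z : ℂ) = ∑' m : ℤ, c m * (z : ℂ) ^ (m + n) := by
    intro z
    have h := hasSum_villainKernel_fourier_circle hβ z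
    rw [villainCircleWeight, ← h.tsum_eq, ← tsum_mul_left]
    refine tsum_congr fun m => ?_
    rw [zpow_add₀ (Circle.coe_ne_zero z)]
    ring
  simp_rw [hexp]
  have h := integral_tsum_mul_coe_zpow_haarProbability_circle c (summable_norm_villainFourierTerm hβ)
    (fun m => m + n) (-n) (fun m => by constructor <;> intro hm <;> linarith)
  rw [hc] at h
  simp only [Int.cast_neg, neg_sq] at h
  exact h

/-- `Z_W = 1/√(2πβ)` for the Villain weight (`β > 0`). [folklore] -/
theorem circleWeightZ_villain (hβ : 0 < β) :
    circleWeightZ (villainCircleWeight β) = 1 / Real.sqrt (2 * π * β) := by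
  have h := integral_coe_zpow_mul_villainCircleWeight hβ 0
  simp only [zpow_zero, one_mul, integral_complex_ofReal, Complex.ofReal_inj, Int.cast_zero] at h
  rw [circleWeightZ, h]
  norm_num

/-- `∫ Im z · v_β(arg z) dz = 0` (the first Fourier coefficient is real). [folklore] -/
theorem integral_im_mul_villainCircleWeight (hβ : 0 < β) :
    ∫ z, (z : ℂ).im * villainCircleWeight β z ∂Measure.haarMeasure (⊤ : PositiveCompacts Circle) = 0 := by
  have h := integral_coe_zpow_mul_villainCircleWeight hβ 1
  have hint : Integrable (fun z : Circle => (z : ℂ) * (villainCircleWeight β z : ℂ))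
      (Measure.haarMeasure (⊤ : PositiveCompacts Circle)) :=
    integrable_of_continuous_of_isFiniteMeasure (X := Circle) _
      (by have := continuous_villainCircleWeight hβ; fun_prop)
  have him := integral_im hint
  simp only [RCLike.im_to_complex, Complex.mul_im, Complex.ofReal_re, Complex.ofReal_im, mul_zero,
    zero_add] at him
  simp only [zpow_one] at h
  rw [him, h, Complex.ofReal_im]

/-- `∫ Re z · v_β(arg z) dz = e^{-1/(2β)}/√(2πβ)`. [folklore] -/
theorem integral_re_mul_villainCircleWeight (hβ : 0 < β) :
    ∫ z, (z : ℂ).re * villainCircleWeight β z ∂Measure.haarMeasure (⊤ : PositiveCompacts Circle) =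
      Real.exp (-1 / (2 * β)) / Real.sqrt (2 * π * β) := by
  have h := integral_coe_zpow_mul_villainCircleWeight hβ 1
  have hint : Integrable (fun z : Circle => (z : ℂ) * (villainCircleWeight β z : ℂ))
      (Measure.haarMeasure (⊤ : PositiveCompacts Circle)) :=
    integrable_of_continuous_of_isFiniteMeasure (X := Circle) _
      (by have := continuous_villainCircleWeight hβ; fun_prop)
  have hre := integral_re hint
  simp only [RCLike.re_to_complex, Complex.mul_re, Complex.ofReal_re, Complex.ofReal_im, mul_zero,
    sub_zero] at hre
  simp only [zpow_one] at h
  rw [hre, h, Complex.ofReal_re]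
  norm_num

/-- **Garban–Spencer's `λ` for the Villain interaction: `λ_{v_β} = e^{-1/(2β)}`** (`β > 0`).
[cite: GarbanSpencer2022, (2.5) and Remark 10] -/
theorem circleWeightMean_villain (hβ : 0 < β) :
    circleWeightMean (villainCircleWeight β) = Real.exp (-1 / (2 * β)) := by
  have hs : 0 < Real.sqrt (2 * π * β) := Real.sqrt_pos.2 (by positivity)
  rw [circleWeightMean, integral_re_mul_villainCircleWeight hβ, circleWeightZ_villain hβ]
  field_simp

/-- `λ_{v_β} > 0`. [folklore] -/
theorem circleWeightMean_villain_pos (hβ : 0 < β) : 0 < circleWeightMean (villainCircleWeight β) := by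
  rw [circleWeightMean_villain hβ]; exact Real.exp_pos _

/-- `λ_{v_β} ≤ 1`. [folklore] -/
theorem circleWeightMean_villain_le_one (hβ : 0 < β) : circleWeightMean (villainCircleWeight β) ≤ 1 := by
  rw [circleWeightMean_villain hβ, Real.exp_le_one_iff]
  exact div_nonpos_of_nonpos_of_nonneg (by norm_num) (by positivity)

/-- **`λ⁻¹ = e^{1/(2β)} ≤ 1 + 2/β` for `β ≥ 1`** (`e^x ≤ 1 + 2x` on `[0, 1]`), the form consumed by the
overlap-moment bookkeeping of the long-range-order proof (cf. `inv_vonMisesMean_le`). [folklore] -/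
theorem inv_circleWeightMean_villain_le (hβ : 1 ≤ β) :
    (circleWeightMean (villainCircleWeight β))⁻¹ ≤ 1 + 2 / β := by
  have hβ0 : 0 < β := lt_of_lt_of_le one_pos hβ
  rw [circleWeightMean_villain hβ0, ← Real.exp_neg, neg_div, neg_neg]
  have hx : |1 / (2 * β)| ≤ 1 := by
    rw [abs_of_nonneg (by positivity), div_le_one (by positivity)]; linarith
  have h := Real.abs_exp_sub_one_le hx
  rw [abs_of_nonneg (by positivity : (0 : ℝ) ≤ 1 / (2 * β))] at h
  have h2 : Real.exp (1 / (2 * β)) ≤ 1 + 2 * (1 / (2 * β)) := by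
    have := (abs_le.1 h).2; linarith
  calc Real.exp (1 / (2 * β)) ≤ 1 + 2 * (1 / (2 * β)) := h2
    _ = 1 + 1 / β := by field_simp
    _ ≤ 1 + 2 / β := by gcongr; norm_num

end Literature.Probability.LatticeModels
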